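import Mathlib.Analysis.SpecialFunctions.Pow.Real
import Mathlib.Algebra.BigOperators.NatAntidiagonal
import Mathlib.Algebra.BigOperators.Intervals
import Mathlib.Algebra.BigOperators.Field
import HarnessLib

/-!
# Isotone cycle weights with `θ_j ≤ j`: deleting a point costs at most one expected cycle

Support file for the Sahi / Conjecture-P programme of route `PercNearOneGluingNoHeavy`
(`--supports stmt-CriticalPhenomena-4575`, prover prim-l12-p5 gen 23; proof note
`prim-l12-p5/LENGTH-GCL-g23.md`, Theorem D1; companion of
`…LowerTailThresholdCycleMonotone` (threshold models)).  No definitions, no named facts, no sorries.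

## The model

Cycle weights `θ_1 ≤ θ_2 ≤ …` (put `θ_0 = 0`) on permutations of `m` points, `P_m(σ) ∝ ∏_{c} θ_{|c|}`.
With `F(x) = ∑_j θ_j x^j / j`, `D = e^F = ∑ u_m x^m` (so `u_m = Z_m/m!`) and `C = F e^F = ∑ v_m x^m`
(so `v_m/u_m = κ_m`, the expected number of cycles), the standard identities `x D' = x F' · D`,
`C = F · D`, `x C' = x F' · (D + C)` read, coefficientwise (sums over the antidiagonal `i + j = m`):
`(hU)  m u_m = ∑ θ_i u_j`,  `(hV₁)  v_m = ∑ (θ_i / i) u_j`,  `(hV₂)  m v_m = ∑ θ_i (u_j + v_j)`.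
These three identities, `θ_0 = 0`, `0 ≤ u_0`, monotonicity of `θ` and the growth condition `θ_j ≤ j`
are the only hypotheses used.

## Result

`fixedPoints_cycles` (**Theorem D1**): `v_{n+1} u_n ≤ u_{n+1} (u_n + v_n)`, i.e. `κ_{n+1} ≤ 1 + κ_n`
("deleting a point costs at most one expected cycle").  Since `E_{n+1}[#cycles | a given point is fixed]
= 1 + κ_n`, this is `Cov_{n+1}(#cycles, #fixed points) ≥ 0`, the case `J = 1` of conjecture GC-L of the
programme (grand-canonical monotonicity), for EVERY `n` and every nondecreasing `θ` with `θ_j ≤ j`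
(in particular all isotone sub-unit weights `θ ≤ 1` at every fugacity `t ≤ 1`).  The hypothesis
`θ_j ≤ j` cannot be dropped (large-scale counterexamples, proof note §6), nor can monotonicity
(the log-superadditive counterexample of the proof note §3 violates exactly this inequality).

Proof (note §5b): with `δ_i = θ_i − θ_{i−1} ≥ 0`, `A = ∑ δ_i u_j`, `B = ∑ δ_i v_j` (antidiagonal `n+1`):
`(n+1) u_{n+1} = n u_n + A`, `(n+1) v_{n+1} = n v_n + A + B` (slack/tight decomposition),
`B ≤ (n+1) u_{n+1}` (from `v_j ≤ ∑_{l ≤ j} u_l`, which is where `θ_i ≤ i` enters, and the Abel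
summation `∑ δ_i U_j = ∑ θ_i u_j`), and `u_n ≤ v_n`; then
`(n+1)[u_{n+1}(u_n+v_n) − v_{n+1}u_n] = n u_n² + A v_n − B u_n ≥ A (v_n − u_n) ≥ 0`.
-/

namespace Summit.CriticalPhenomena.PercolationContinuityZ3.Theorems

namespace FixedPointsCycles

open Finset

variable {θ u v : ℕ → ℝ}

/-- `θ ≥ 0` for a nondecreasing sequence with `θ_0 = 0`. -/
theorem theta_nonneg (hθ0 : θ 0 = 0) (hmono : ∀ i, θ i ≤ θ (i + 1)) : ∀ i, 0 ≤ θ i := by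
  intro i
  induction i with
  | zero => rw [hθ0]
  | succ i ih => exact ih.trans (hmono i)

/-- `u ≥ 0`, from `m u_m = ∑_{i+j=m} θ_i u_j`, `θ ≥ 0`, `θ_0 = 0`, `u_0 ≥ 0`. -/
theorem u_nonneg (hθ0 : θ 0 = 0) (hmono : ∀ i, θ i ≤ θ (i + 1)) (hu0 : 0 ≤ u 0)
    (hU : ∀ m : ℕ, (m : ℝ) * u m = ∑ p ∈ antidiagonal m, θ p.1 * u p.2) : ∀ m, 0 ≤ u m := by
  have hθ := theta_nonneg hθ0 hmono
  intro m
  induction m using Nat.strong_induction_on with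
  | _ m ih =>
    rcases Nat.eq_zero_or_pos m with rfl | hm
    · exact hu0
    have hsum : 0 ≤ ∑ p ∈ antidiagonal m, θ p.1 * u p.2 := by
      apply Finset.sum_nonneg
      intro p hp
      rw [Finset.mem_antidiagonal] at hp
      rcases Nat.eq_zero_or_pos p.1 with h0 | hpos
      · rw [h0, hθ0, zero_mul]
      · exact mul_nonneg (hθ _) (ih p.2 (by omega))
    rw [← hU m] at hsum
    have hmpos : (0 : ℝ) < (m : ℝ) := by exact_mod_cast hm
    exact (mul_nonneg_iff_of_pos_left hmpos).1 hsum

/-- `v ≥ 0`, from `v_m = ∑ (θ_i/i) u_j`. -/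
theorem v_nonneg (hθ0 : θ 0 = 0) (hmono : ∀ i, θ i ≤ θ (i + 1)) (hu0 : 0 ≤ u 0)
    (hU : ∀ m : ℕ, (m : ℝ) * u m = ∑ p ∈ antidiagonal m, θ p.1 * u p.2)
    (hV₁ : ∀ m, v m = ∑ p ∈ antidiagonal m, θ p.1 / p.1 * u p.2) : ∀ m, 0 ≤ v m := by
  have hθ := theta_nonneg hθ0 hmono
  have hu := u_nonneg hθ0 hmono hu0 hU
  intro m
  rw [hV₁ m]
  exact Finset.sum_nonneg fun p _ => mul_nonneg (div_nonneg (hθ _) (Nat.cast_nonneg _)) (hu _)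

/-- Every permutation of `m ≥ 1` points has at least one cycle: `u_m ≤ v_m`. -/
theorem u_le_v (hθ0 : θ 0 = 0) (hmono : ∀ i, θ i ≤ θ (i + 1)) (hu0 : 0 ≤ u 0)
    (hU : ∀ m : ℕ, (m : ℝ) * u m = ∑ p ∈ antidiagonal m, θ p.1 * u p.2)
    (hV₁ : ∀ m, v m = ∑ p ∈ antidiagonal m, θ p.1 / p.1 * u p.2) :
    ∀ m, 1 ≤ m → u m ≤ v m := by
  have hθ := theta_nonneg hθ0 hmono
  have hu := u_nonneg hθ0 hmono hu0 hU
  intro m hm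
  have hmpos : (0 : ℝ) < (m : ℝ) := by exact_mod_cast hm
  -- v_m ≥ (1/m) ∑ θ_i u_j = u_m
  have key : ∑ p ∈ antidiagonal m, θ p.1 / m * u p.2 ≤ ∑ p ∈ antidiagonal m, θ p.1 / p.1 * u p.2 := by
    apply Finset.sum_le_sum
    intro p hp
    rw [Finset.mem_antidiagonal] at hp
    rcases Nat.eq_zero_or_pos p.1 with h0 | hpos
    · rw [h0, hθ0]; simp
    · apply mul_le_mul_of_nonneg_right _ (hu _)
      apply div_le_div_of_nonneg_left (hθ _) (by exact_mod_cast hpos)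
      exact_mod_cast (show p.1 ≤ m by omega)
  have hsum : ∑ p ∈ antidiagonal m, θ p.1 / m * u p.2 = u m := by
    have : ∑ p ∈ antidiagonal m, θ p.1 / m * u p.2 = (∑ p ∈ antidiagonal m, θ p.1 * u p.2) / m := by
      rw [Finset.sum_div]
      exact Finset.sum_congr rfl fun p _ => by ring
    rw [this, ← hU m]
    field_simp
  rw [hV₁ m, ← hsum]
  exact key

/-- `v_j ≤ ∑_{l ≤ j} u_l` — the only place where `θ_i ≤ i` is used. -/
theorem v_le_partialSum (hθ0 : θ 0 = 0) (hmono : ∀ i, θ i ≤ θ (i + 1)) (hle : ∀ i, θ i ≤ i)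
    (hu0 : 0 ≤ u 0) (hU : ∀ m : ℕ, (m : ℝ) * u m = ∑ p ∈ antidiagonal m, θ p.1 * u p.2)
    (hV₁ : ∀ m, v m = ∑ p ∈ antidiagonal m, θ p.1 / p.1 * u p.2) (j : ℕ) :
    v j ≤ ∑ l ∈ range (j + 1), u l := by
  have hθ := theta_nonneg hθ0 hmono
  have hu := u_nonneg hθ0 hmono hu0 hU
  rw [hV₁ j]
  calc ∑ p ∈ antidiagonal j, θ p.1 / p.1 * u p.2 ≤ ∑ p ∈ antidiagonal j, u p.2 := by
        apply Finset.sum_le_sum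
        intro p _
        have h1 : θ p.1 / p.1 ≤ 1 := by
          rcases Nat.eq_zero_or_pos p.1 with h0 | hpos
          · rw [h0]; simp
          · rw [div_le_one (by exact_mod_cast hpos)]; exact hle _
        calc θ p.1 / p.1 * u p.2 ≤ 1 * u p.2 := mul_le_mul_of_nonneg_right h1 (hu _)
          _ = u p.2 := one_mul _
    _ = ∑ k ∈ range (j + 1), u (j - k) := by
        rw [Finset.Nat.sum_antidiagonal_eq_sum_range_succ (fun _ l => u l) j]
    _ = ∑ l ∈ range (j + 1), u l := Finset.sum_range_reflect u (j + 1)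

/-- Abel summation on the antidiagonal: `∑_{i+j=n} (θ_i − θ_{i−1}) U_j = ∑_{i+j=n} θ_i u_j`,
`U_j = ∑_{l ≤ j} u_l` (with `θ_0 = 0`; `θ_{0-1} = θ_0` by truncated subtraction). -/
theorem abel_antidiagonal (hθ0 : θ 0 = 0) (n : ℕ) :
    ∑ p ∈ antidiagonal n, (θ p.1 - θ (p.1 - 1)) * ∑ l ∈ range (p.2 + 1), u l =
      ∑ p ∈ antidiagonal n, θ p.1 * u p.2 := by
  rcases n with _ | n
  · simp [hθ0]
  · -- split the difference
    have h1 : ∑ p ∈ antidiagonal (n + 1), θ (p.1 - 1) * ∑ l ∈ range (p.2 + 1), u l =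
        ∑ p ∈ antidiagonal n, θ p.1 * ∑ l ∈ range (p.2 + 1), u l := by
      rw [Finset.Nat.sum_antidiagonal_succ]
      simp [hθ0]
    have h2 : ∑ p ∈ antidiagonal (n + 1), θ p.1 * ∑ l ∈ range (p.2 + 1), u l =
        ∑ p ∈ antidiagonal (n + 1), θ p.1 * u p.2 +
          ∑ p ∈ antidiagonal n, θ p.1 * ∑ l ∈ range (p.2 + 1), u l := by
      rw [Finset.Nat.sum_antidiagonal_succ' (f := fun p => θ p.1 * ∑ l ∈ range (p.2 + 1), u l),
        Finset.Nat.sum_antidiagonal_succ' (f := fun p => θ p.1 * u p.2)]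
      have e2 : ∀ p : ℕ × ℕ, θ p.1 * ∑ l ∈ range (p.2 + 1 + 1), u l =
          θ p.1 * u (p.2 + 1) + θ p.1 * ∑ l ∈ range (p.2 + 1), u l := by
        intro p; rw [Finset.sum_range_succ]; ring
      simp only [e2, Finset.sum_add_distrib, zero_add, Finset.sum_range_one]
      ring
    calc ∑ p ∈ antidiagonal (n + 1), (θ p.1 - θ (p.1 - 1)) * ∑ l ∈ range (p.2 + 1), u l
        = ∑ p ∈ antidiagonal (n + 1), θ p.1 * ∑ l ∈ range (p.2 + 1), u l -
            ∑ p ∈ antidiagonal (n + 1), θ (p.1 - 1) * ∑ l ∈ range (p.2 + 1), u l := by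
          rw [← Finset.sum_sub_distrib]
          exact Finset.sum_congr rfl fun p _ => by ring
      _ = ∑ p ∈ antidiagonal (n + 1), θ p.1 * u p.2 := by rw [h1, h2]; ring

/-- **Key bound** (`(†)` of the proof note): `∑_{i+j=n} δ_i v_j ≤ n u_n`, i.e. on the event that the
cycle of a given point is "tight" the expected number of OTHER cycles is at most `1`. -/
theorem tight_sum_le (hθ0 : θ 0 = 0) (hmono : ∀ i, θ i ≤ θ (i + 1)) (hle : ∀ i, θ i ≤ i)
    (hu0 : 0 ≤ u 0) (hU : ∀ m : ℕ, (m : ℝ) * u m = ∑ p ∈ antidiagonal m, θ p.1 * u p.2)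
    (hV₁ : ∀ m, v m = ∑ p ∈ antidiagonal m, θ p.1 / p.1 * u p.2) (n : ℕ) :
    ∑ p ∈ antidiagonal n, (θ p.1 - θ (p.1 - 1)) * v p.2 ≤ (n : ℝ) * u n := by
  have hδ : ∀ i, 0 ≤ θ i - θ (i - 1) := by
    intro i
    rcases i with _ | i
    · simp
    · simp only [Nat.add_sub_cancel]; linarith [hmono i]
  calc ∑ p ∈ antidiagonal n, (θ p.1 - θ (p.1 - 1)) * v p.2
      ≤ ∑ p ∈ antidiagonal n, (θ p.1 - θ (p.1 - 1)) * ∑ l ∈ range (p.2 + 1), u l :=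
        Finset.sum_le_sum fun p _ =>
          mul_le_mul_of_nonneg_left (v_le_partialSum hθ0 hmono hle hu0 hU hV₁ _) (hδ _)
    _ = ∑ p ∈ antidiagonal n, θ p.1 * u p.2 := abel_antidiagonal hθ0 n
    _ = (n : ℝ) * u n := (hU n).symm

/-- Slack/tight decomposition of `u`: `(n+1) u_{n+1} = n u_n + ∑_{i+j=n+1} δ_i u_j`. -/
theorem u_slack_tight (hθ0 : θ 0 = 0)
    (hU : ∀ m : ℕ, (m : ℝ) * u m = ∑ p ∈ antidiagonal m, θ p.1 * u p.2) (n : ℕ) :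
    ((n + 1 : ℕ) : ℝ) * u (n + 1) =
      (n : ℝ) * u n + ∑ p ∈ antidiagonal (n + 1), (θ p.1 - θ (p.1 - 1)) * u p.2 := by
  have h1 : ∑ p ∈ antidiagonal (n + 1), θ (p.1 - 1) * u p.2 = ∑ p ∈ antidiagonal n, θ p.1 * u p.2 := by
    rw [Finset.Nat.sum_antidiagonal_succ]; simp [hθ0]
  rw [hU (n + 1), hU n, ← h1, ← Finset.sum_add_distrib]
  exact Finset.sum_congr rfl fun p _ => by ring

/-- Slack/tight decomposition of `v`: `(n+1) v_{n+1} = n v_n + ∑ δ_i u_j + ∑ δ_i v_j`. -/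
theorem v_slack_tight (hθ0 : θ 0 = 0)
    (hV₂ : ∀ m : ℕ, (m : ℝ) * v m = ∑ p ∈ antidiagonal m, θ p.1 * (u p.2 + v p.2)) (n : ℕ) :
    ((n + 1 : ℕ) : ℝ) * v (n + 1) =
      (n : ℝ) * v n + ∑ p ∈ antidiagonal (n + 1), (θ p.1 - θ (p.1 - 1)) * u p.2 +
        ∑ p ∈ antidiagonal (n + 1), (θ p.1 - θ (p.1 - 1)) * v p.2 := by
  have h1 : ∑ p ∈ antidiagonal (n + 1), θ (p.1 - 1) * (u p.2 + v p.2) =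
      ∑ p ∈ antidiagonal n, θ p.1 * (u p.2 + v p.2) := by
    rw [Finset.Nat.sum_antidiagonal_succ]; simp [hθ0]
  rw [hV₂ (n + 1), hV₂ n, ← h1, add_assoc, ← Finset.sum_add_distrib, ← Finset.sum_add_distrib]
  exact Finset.sum_congr rfl fun p _ => by ring

/-- **Theorem D1 (fixed points are positively correlated with the number of cycles).**
For nondecreasing cycle weights `θ` with `θ_0 = 0`, `θ_j ≤ j`, and the EGF data `u, v` of the model
(normalised partition functions and cycle-count sums, characterised by `(hU), (hV₁), (hV₂)`):
`v_{n+1} u_n ≤ u_{n+1} (u_n + v_n)`, i.e. `κ_{n+1} ≤ 1 + κ_n`, i.e. `Cov_{n+1}(#cycles, #fixed points) ≥ 0`. -/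
theorem fixedPoints_cycles (hθ0 : θ 0 = 0) (hmono : ∀ i, θ i ≤ θ (i + 1)) (hle : ∀ i, θ i ≤ i)
    (hu0 : 0 ≤ u 0) (hU : ∀ m : ℕ, (m : ℝ) * u m = ∑ p ∈ antidiagonal m, θ p.1 * u p.2)
    (hV₁ : ∀ m, v m = ∑ p ∈ antidiagonal m, θ p.1 / p.1 * u p.2)
    (hV₂ : ∀ m : ℕ, (m : ℝ) * v m = ∑ p ∈ antidiagonal m, θ p.1 * (u p.2 + v p.2)) (n : ℕ) :
    v (n + 1) * u n ≤ u (n + 1) * (u n + v n) := by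
  have hu := u_nonneg hθ0 hmono hu0 hU
  have hδ : ∀ i, 0 ≤ θ i - θ (i - 1) := by
    intro i
    rcases i with _ | i
    · simp
    · simp only [Nat.add_sub_cancel]; linarith [hmono i]
  -- abbreviations (terms, not definitions)
  have hA : 0 ≤ ∑ p ∈ antidiagonal (n + 1), (θ p.1 - θ (p.1 - 1)) * u p.2 :=
    Finset.sum_nonneg fun p _ => mul_nonneg (hδ _) (hu _)
  have hUst := u_slack_tight hθ0 hU n
  have hVst := v_slack_tight hθ0 hV₂ n
  have hB := tight_sum_le hθ0 hmono hle hu0 hU hV₁ (n + 1)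
  have hN : (0 : ℝ) < ((n + 1 : ℕ) : ℝ) := by positivity
  rcases Nat.eq_zero_or_pos n with rfl | hn
  · -- n = 0: v_1 u_0 = u_1 (u_0 + v_0), since v_0 = 0 and u_1 = v_1 = θ_1 u_0
    have hv0 : v 0 = 0 := by rw [hV₁ 0]; simp [hθ0]
    have hu1 : u 1 = θ 1 * u 0 := by
      have := hU 1
      rw [Finset.Nat.antidiagonal_succ] at this
      simpa [hθ0] using this
    have hv1 : v 1 = θ 1 * u 0 := by
      rw [hV₁ 1, Finset.Nat.antidiagonal_succ]; simp [hθ0]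
    rw [hv0, hu1, hv1, add_zero]
  · have huv : u n ≤ v n := u_le_v hθ0 hmono hu0 hU hV₁ n hn
    -- multiply the goal by (n+1) > 0
    have key : ((n + 1 : ℕ) : ℝ) * (u (n + 1) * (u n + v n) - v (n + 1) * u n) ≥ 0 := by
      have e : ((n + 1 : ℕ) : ℝ) * (u (n + 1) * (u n + v n) - v (n + 1) * u n) =
          (((n + 1 : ℕ) : ℝ) * u (n + 1)) * (u n + v n) - (((n + 1 : ℕ) : ℝ) * v (n + 1)) * u n := by
        ring
      rw [e, hUst, hVst]
      -- = n u_n² + A v_n − B u_n ≥ A (v_n − u_n) ≥ 0, using B ≤ (n+1) u_{n+1} = n u_n + A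
      rw [hUst] at hB
      nlinarith [hB, hA, huv, hu n, mul_nonneg hA (sub_nonneg.2 huv)]
    have h2 : 0 ≤ u (n + 1) * (u n + v n) - v (n + 1) * u n :=
      (mul_nonneg_iff_of_pos_left hN).1 (by linarith [key])
    linarith

end FixedPointsCycles

end Summit.CriticalPhenomena.PercolationContinuityZ3.Theorems
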